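/-
Copyright (c) 2026 the pub-hodgecm-mathlib formalisation cell (harness21).  Prover seat hodgecm-mathlib-F0P2-p10 (g2), Track B «K2-LIT»,
#184♮ = hLiu418 = `stmt-HodgeConjecture-24832`; socket #41, KIND 1, organ (K1b-W) «KIND W AT `n := 1` FOR THE PULLED-BACK FAMILY» (line lead K2Liu-p14 (g4) FILE CUT
2026-09-04T22:32:01Z; LEAD F0P6-plan (g14) BATCH #85 (2) ∕ #87: «F0P2-p10 → (KW1-e) `…LineWhittakerTranslate` (the translate seam)»), PART 1: THE STRUCTURE OF THE TRANSLATED CORNER FAMILY.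
THEOREMS ONLY (no `def`, no `instance`, no notation, no named-fact hypothesis, no `sorry`).
-/
import Summits.HodgeConjecture.HodgeConjecture.Theorems.K2LiuBlockDiagSectionPullback      -- ★ (T4-α) pt 1 (F0P2-p11 (g2), p862495): `isSiegelDeltaSection_comp_blkD_inr`, `continuous_comp_blkD_inr`
import Literature.NumberTheory.K2Lit.SiegelHolomorphicSections                            -- ★ `IsSiegelDeltaSection.smul`, `.rightTranslate`
import HarnessLib

/-!
# Crux `HLiu418`, socket #41, KIND 1 ∕ organ (K1b-W), file (KW1-e) PART 1 — `K2LiuKindOneLineWhittakerTranslate`: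
# THE TRANSLATED CORNER FAMILY `Φ^{(p₀,g)}_s(x) := f_s(p₀ · blkD(1, x) · g)` IS `σ_{χ,s}(p₀) · f_s(blkD(1, x) · g)` — a Siegel family of `I⁽¹⁾(s + n₁∕2, χ)` for
# EVERY translate `g ∈ H(𝔸)`, continuous in `x`, holomorphic in `s` wherever `f` is

Cell `hodgecm-mathlib`, crux item hLiu418 = `stmt-HodgeConjecture-24832` (route of record `HCCMUnconditional`); squad K2 ∕ K2Liu, road `K2_Liu`, socket #41
`sig_K2LiuSiegelEisensteinContinuation`, KIND 1, the K1-b♮ LINE TERM (F0P2-p11 (g2) memo `F0/P2/F0P2-p11/g2/CENSUS-K1-DealTable.F0P2-p11-g2.md` §2): after ★ (R1-α)(b)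
`K2LiuRankOneMiddleTermCorner` and (T4-β) the line term is `C · W⁽¹⁾_{μ_S}(x ↦ f_s(p₀ · ȷ x · Λĝ h))(1)` with `ȷ = blkD (1, ·)` Kudla's see-saw chart of the doubled LINE
`H₁ = H(V₂)` into `H = H(V₁ ⊕ V₂)` (★ Literature `GRConstruction.blkD`; F0P2-p11's (T4-α) pt 1 ★ p862495).  The (K1b-W) organ (K2Liu-p14 (g4) cut: (KW1-a) holomorphy, (b) Euler,
(c) support, (d) decay, (pkg)) runs KIND W at `n := 1` over an ABSTRACT pulled-back family; THIS FILE is the seam (KW1-e), PART 1: the abstract family's STRUCTURAL hypotheses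
DISCHARGED for the actual translated corner family, for EVERY `g ∈ H(𝔸)` and every `p₀ ∈ P_Δ(𝔸)` — no Klingen–Iwasawa decomposition of `g` is needed, because ★ p862495
already pulls Siegel sections back along `x ↦ blkD (1, x) · g` for arbitrary `g`, and `p₀` on the LEFT only contributes the scalar `σ_{χ,s}(p₀)` by the section law.
THEOREMS ONLY (no `def`, no `instance`, no notation, no named-fact hypothesis, no `sorry`); lane `--supports stmt-HodgeConjecture-24832 --as helper` (count-neutral).
Generic ranks as in ★ p862495 (`V = V₁ ⊕ V₂`, `dV = dA ‖ dB`, enumerations `eV eA eB`; the K1 instance is `N₁ = N₂ = M = 1`, `n₁ = n₂ = 1`, shift `n₁∕2 = ½`).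

* §1 `cornerTranslate_eq_mul` — `f (p₀ · blkD(1,x) · g) = σ_{χ,s}(p₀) · f (blkD(1,x) · g)` (section law, `p₀` left); `norm_cornerTranslate_eq`; `cornerTranslate_mul`
  (`blkD (1, x·y)` — the family's own right translates stay in the family: «fixed `Φ`, variable `x`»).
* §2 **`isSiegelDeltaSection_cornerTranslate`** — `x ↦ f (p₀ · blkD(1,x) · g)` is a Siegel section of `I⁽ᴮ⁾(s + n₁∕2, χ)` (★ p862495 `isSiegelDeltaSection_comp_blkD_inr` + ★
  `IsSiegelDeltaSection.smul`); families version `isSiegelDeltaSection_family_cornerTranslate`.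
* §3 `continuous_cornerTranslate` (★ `continuous_blkD`); `differentiableOn_cornerTranslate` (holomorphy in `s` is pointwise in the argument, hence inherited);
  `cornerTranslate_family_eq_mul` (the scalar `s ↦ σ_{χ,s}(p₀)` — entire, ★ `differentiable_siegelDeltaCharacter` — factored out as functions of `s`).
PARTS 2–3 (census 2026-09-04T22:4xZ, separate files): (e2) the PLACE COMPONENTS of `blkD (1, ·)` (adelic ↔ local see-saw chart; Literature has the local chart for the first summand
only, ★ `LocalDoubledBlockEmbedding.blkLoc`), (e3) FACTORIZABILITY TRANSPORT `IsFactorizableOff T χ f fT → IsFactorizableOff⁽ᴮ⁾ (T ∪ {v : g_v ∉ K_v}) χ Φ^{(1,g)} fT′` with the local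
spherical pull-back `Λ_{s,v}(blkD_v(1,y)·k) = Λ⁽ᴮ⁾_{s+n₁∕2,v}(y)`.
[KudlaRallis1994, §2]; [Kudla1994, §2, Thm. 3.1]; [Tan1999, §1]; [MoeglinWaldspurger1995, II.1.7]; [Shimura1997, §18.4].
HONEST LABEL.  Count-neutral helper, closes no socket: `HC_CM` is proved only modulo the 7 printed citations (2 remaining named inputs: hLiu418 =
`stmt-HodgeConjecture-24832`, h413 = `stmt-HodgeConjecture-24833`) until rung 0 closes.

## References
* [KudlaRallis1994] S. S. Kudla, S. Rallis, *A regularized Siegel–Weil formula: the first term identity*, Ann. of Math. 140 (1994), §2 (degenerate principal series, translates).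
* [Kudla1994] S. S. Kudla, *Splitting metaplectic covers of dual reductive pairs*, Israel J. Math. 87 (1994), §2, Thm. 3.1 (the see-saw embedding and the Siegel parabolic).
* [Tan1999] V. Tan, *Poles of Siegel Eisenstein series on U(n,n)*, Canad. J. Math. 51 (1999), §1 (sections of `I(s, χ)`).
* [MoeglinWaldspurger1995] C. Mœglin, J.-L. Waldspurger, *Spectral decomposition and Eisenstein series* (1995), II.1.7.
* [Shimura1997] G. Shimura, *Euler Products and Eisenstein Series*, CBMS 93 (1997), §18.4 (Fourier coefficients of lower rank).
-/

set_option autoImplicit false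
set_option linter.dupNamespace false -- the mandated namespace repeats `HodgeConjecture.HodgeConjecture`

noncomputable section

open scoped Matrix
open NumberField IsDedekindDomain
open Literature.NumberTheory.Automorphic Literature.NumberTheory.GaloisRepresentations
open Literature.NumberTheory.GelbartRogawski1991 Literature.NumberTheory.GelbartRogawski1991.GRConstruction
open Literature.NumberTheory.K2Lit.SiegelDoubled
open Summit.HodgeConjecture.HodgeConjecture.Cruxes.HLiu418.K2LiuBlockDiagSectionPullback (isSiegelDeltaSection_comp_blkD_inr)

namespace Summit.HodgeConjecture.HodgeConjecture.Cruxes.HLiu418.K2LiuKindOneLineWhittakerTranslate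

variable (L : Type) [Field L] [NumberField L] [IsCMField L]
variable {N₁ N₂ M n n₁ n₂ : ℕ} (eV : Fin (N₁ + N₂) × Fin M ≃ Fin n) (eA : Fin N₁ × Fin M ≃ Fin n₁) (eB : Fin N₂ × Fin M ≃ Fin n₂)
  (dA : Fin N₁ → L) (hdA : ∀ i, IsCMField.complexConj L (dA i) = dA i)
  (dB : Fin N₂ → L) (hdB : ∀ i, IsCMField.complexConj L (dB i) = dB i)
  (dV : Fin (N₁ + N₂) → L) (hdV : ∀ i, IsCMField.complexConj L (dV i) = dV i)
  (hVA : ∀ i, dV (Fin.castAdd N₂ i) = dA i) (hVB : ∀ j, dV (Fin.natAdd N₁ j) = dB j)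
  (dW : Fin M → L) (hdW : ∀ i, IsCMField.complexConj L (dW i) = dW i)

/-! ## §1 The section law with `p₀` on the left; the family is closed under its own right translates -/

/-- **`f (p₀ · blkD(1,x) · g) = σ_{χ,s}(p₀) · f (blkD(1,x) · g)`** for a Siegel section `f ∈ I_Δ^{(V)}(s, χ)` and `p₀ ∈ P_Δ(V)(𝔸)` — the left factor `p₀` (of `w₀ ∈ P_Δ · blkD(1, w_Δ⁽¹⁾)`)
is a SCALAR on the whole translated corner family. [cite: Tan1999, §1] [cite: KudlaRallis1994, §2] -/
theorem cornerTranslate_eq_mul {χ : HeckeCharacter L} {s : ℂ} {f : HA L eV dV hdV dW hdW → ℂ} (hf : IsSiegelDeltaSection L eV dV hdV dW hdW χ s f)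
    {p₀ : HA L eV dV hdV dW hdW} (hp₀ : IsSiegelDelta L eV dV hdV dW hdW p₀) (g : HA L eV dV hdV dW hdW) (x : HA L eB dB hdB dW hdW) :
    f (p₀ * blkD L eV eA eB dA hdA dB hdB dV hdV hVA hVB dW hdW (1, x) * g) =
      siegelDeltaCharacter L eV dV hdV dW hdW χ s p₀ * f (blkD L eV eA eB dA hdA dB hdB dV hdV hVA hVB dW hdW (1, x) * g) := by
  rw [mul_assoc]
  exact hf p₀ hp₀ _

/-- hence `‖f (p₀ · blkD(1,x) · g)‖ = ‖σ_{χ,s}(p₀)‖ · ‖f (blkD(1,x) · g)‖` — the growth letters of the translated family are those of `x ↦ f (blkD(1,x) · g)` times ONE scalar.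
[cite: Tan1999, §1] -/
theorem norm_cornerTranslate_eq {χ : HeckeCharacter L} {s : ℂ} {f : HA L eV dV hdV dW hdW → ℂ} (hf : IsSiegelDeltaSection L eV dV hdV dW hdW χ s f)
    {p₀ : HA L eV dV hdV dW hdW} (hp₀ : IsSiegelDelta L eV dV hdV dW hdW p₀) (g : HA L eV dV hdV dW hdW) (x : HA L eB dB hdB dW hdW) :
    ‖f (p₀ * blkD L eV eA eB dA hdA dB hdB dV hdV hVA hVB dW hdW (1, x) * g)‖ =
      ‖siegelDeltaCharacter L eV dV hdV dW hdW χ s p₀‖ * ‖f (blkD L eV eA eB dA hdA dB hdB dV hdV hVA hVB dW hdW (1, x) * g)‖ := by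
  rw [cornerTranslate_eq_mul L eV eA eB dA hdA dB hdB dV hdV hVA hVB dW hdW hf hp₀ g x, norm_mul]

/-- **the family is closed under its own right translates**: `f (p₀ · blkD(1, x·y) · g) = f (p₀ · blkD(1, x) · (blkD(1, y) · g))` (`blkD` is a homomorphism) — «fixed family,
variable `x`»: the `H₁(𝔸)`-translates needed by the rank-one Whittaker theory never leave the translated corner families. [cite: Kudla1994, §2] -/
theorem cornerTranslate_mul (f : HA L eV dV hdV dW hdW → ℂ) (p₀ g : HA L eV dV hdV dW hdW) (x y : HA L eB dB hdB dW hdW) :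
    f (p₀ * blkD L eV eA eB dA hdA dB hdB dV hdV hVA hVB dW hdW (1, x * y) * g) =
      f (p₀ * blkD L eV eA eB dA hdA dB hdB dV hdV hVA hVB dW hdW (1, x) * (blkD L eV eA eB dA hdA dB hdB dV hdV hVA hVB dW hdW (1, y) * g)) := by
  have hmul : blkD L eV eA eB dA hdA dB hdB dV hdV hVA hVB dW hdW (1, x * y) =
      blkD L eV eA eB dA hdA dB hdB dV hdV hVA hVB dW hdW (1, x) * blkD L eV eA eB dA hdA dB hdB dV hdV hVA hVB dW hdW (1, y) := by
    rw [← map_mul, Prod.mk_mul_mk, mul_one]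
  rw [hmul]
  simp only [mul_assoc]

/-- at `x = 1` the translated corner family reads `f (p₀ · g)` (`blkD (1, 1) = 1`). [cite: Kudla1994, §2] -/
theorem cornerTranslate_one (f : HA L eV dV hdV dW hdW → ℂ) (p₀ g : HA L eV dV hdV dW hdW) :
    f (p₀ * blkD L eV eA eB dA hdA dB hdB dV hdV hVA hVB dW hdW (1, (1 : HA L eB dB hdB dW hdW)) * g) = f (p₀ * g) := by
  rw [show ((1 : HA L eA dA hdA dW hdW), (1 : HA L eB dB hdB dW hdW)) = 1 from rfl, map_one, mul_one]

/-! ## §2 The translated corner family is a Siegel family of `I⁽ᴮ⁾(s + n₁∕2, χ)` -/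

/-- **`x ↦ f (p₀ · blkD(1,x) · g)` IS A SIEGEL SECTION OF `I_Δ^{(V₂)}(s + n₁∕2, χ)`** for every `f ∈ I_Δ^{(V)}(s, χ)`, `p₀ ∈ P_Δ(V)(𝔸)`, `g ∈ H(V)(𝔸)`
(★ p862495 `isSiegelDeltaSection_comp_blkD_inr` at the translate `g`, times the scalar `σ_{χ,s}(p₀)` by ★ `IsSiegelDeltaSection.smul`).  At `N₁ = N₂ = M = 1` this is the K1-b♮
line term's inner family at parameter `s + ½`. [cite: KudlaRallis1994, §2] [cite: Kudla1994, §2, Thm. 3.1] [cite: Tan1999, §1] -/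
theorem isSiegelDeltaSection_cornerTranslate {χ : HeckeCharacter L} {s : ℂ} {f : HA L eV dV hdV dW hdW → ℂ} (hf : IsSiegelDeltaSection L eV dV hdV dW hdW χ s f)
    {p₀ : HA L eV dV hdV dW hdW} (hp₀ : IsSiegelDelta L eV dV hdV dW hdW p₀) (g : HA L eV dV hdV dW hdW) :
    IsSiegelDeltaSection L eB dB hdB dW hdW χ (s + (n₁ : ℂ) / 2)
      (fun x => f (p₀ * blkD L eV eA eB dA hdA dB hdB dV hdV hVA hVB dW hdW (1, x) * g)) := by
  have hfun : (fun x => f (p₀ * blkD L eV eA eB dA hdA dB hdB dV hdV hVA hVB dW hdW (1, x) * g)) =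
      siegelDeltaCharacter L eV dV hdV dW hdW χ s p₀ • fun x => f (blkD L eV eA eB dA hdA dB hdB dV hdV hVA hVB dW hdW (1, x) * g) := by
    funext x
    rw [Pi.smul_apply, smul_eq_mul]
    exact cornerTranslate_eq_mul L eV eA eB dA hdA dB hdB dV hdV hVA hVB dW hdW hf hp₀ g x
  rw [hfun]
  exact (isSiegelDeltaSection_comp_blkD_inr L eV eA eB dA hdA dB hdB dV hdV hVA hVB dW hdW hf g).smul _

/-- families version: for a family `f_s ∈ I_Δ^{(V)}(s, χ)` the translated corner family `s ↦ (x ↦ f_s (p₀ · blkD(1,x) · g))` is a family of Siegel sections of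
`I_Δ^{(V₂)}(s + n₁∕2, χ)`. [cite: KudlaRallis1994, §2] [cite: Tan1999, §1] -/
theorem isSiegelDeltaSection_family_cornerTranslate {χ : HeckeCharacter L} {f : ℂ → HA L eV dV hdV dW hdW → ℂ}
    (hf : ∀ s, IsSiegelDeltaSection L eV dV hdV dW hdW χ s (f s)) {p₀ : HA L eV dV hdV dW hdW} (hp₀ : IsSiegelDelta L eV dV hdV dW hdW p₀)
    (g : HA L eV dV hdV dW hdW) (s : ℂ) :
    IsSiegelDeltaSection L eB dB hdB dW hdW χ (s + (n₁ : ℂ) / 2)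
      (fun x => f s (p₀ * blkD L eV eA eB dA hdA dB hdB dV hdV hVA hVB dW hdW (1, x) * g)) :=
  isSiegelDeltaSection_cornerTranslate L eV eA eB dA hdA dB hdB dV hdV hVA hVB dW hdW (hf s) hp₀ g

/-- the right translates of the translated corner family by `H(V₂)(𝔸)` are again Siegel sections of `I_Δ^{(V₂)}(s + n₁∕2, χ)` (★ `IsSiegelDeltaSection.rightTranslate`).
[cite: Tan1999, §1] -/
theorem isSiegelDeltaSection_cornerTranslate_rightTranslate {χ : HeckeCharacter L} {s : ℂ} {f : HA L eV dV hdV dW hdW → ℂ}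
    (hf : IsSiegelDeltaSection L eV dV hdV dW hdW χ s f) {p₀ : HA L eV dV hdV dW hdW} (hp₀ : IsSiegelDelta L eV dV hdV dW hdW p₀) (g : HA L eV dV hdV dW hdW)
    (y : HA L eB dB hdB dW hdW) :
    IsSiegelDeltaSection L eB dB hdB dW hdW χ (s + (n₁ : ℂ) / 2)
      (fun x => f (p₀ * blkD L eV eA eB dA hdA dB hdB dV hdV hVA hVB dW hdW (1, x * y) * g)) :=
  (isSiegelDeltaSection_cornerTranslate L eV eA eB dA hdA dB hdB dV hdV hVA hVB dW hdW hf hp₀ g).rightTranslate y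

/-! ## §3 Continuity in `x` and holomorphy in `s` -/

/-- **continuity**: `x ↦ f (p₀ · blkD(1,x) · g)` is continuous on `H(V₂)(𝔸)` when `f` is (★ `continuous_blkD`). [cite: Kudla1994, §2] -/
theorem continuous_cornerTranslate {f : HA L eV dV hdV dW hdW → ℂ} (hfc : Continuous f) (p₀ g : HA L eV dV hdV dW hdW) :
    Continuous fun x : HA L eB dB hdB dW hdW => f (p₀ * blkD L eV eA eB dA hdA dB hdB dV hdV hVA hVB dW hdW (1, x) * g) :=
  hfc.comp ((continuous_const.mul ((continuous_blkD L eV eA eB dA hdA dB hdB dV hdV hVA hVB dW hdW).comp (continuous_const.prodMk continuous_id))).mul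
    continuous_const)

/-- **holomorphy in `s`** is pointwise in the argument, hence inherited verbatim: if `s ↦ f_s(y)` is holomorphic on `U` for every `y`, so is
`s ↦ f_s(p₀ · blkD(1,x) · g)` (the case `y := p₀ · blkD(1,x) · g`). [cite: KudlaRallis1994, §2] -/
theorem differentiableOn_cornerTranslate {f : ℂ → HA L eV dV hdV dW hdW → ℂ} {U : Set ℂ}
    (hhol : ∀ y : HA L eV dV hdV dW hdW, DifferentiableOn ℂ (fun s => f s y) U) (p₀ g : HA L eV dV hdV dW hdW) (x : HA L eB dB hdB dW hdW) :
    DifferentiableOn ℂ (fun s => f s (p₀ * blkD L eV eA eB dA hdA dB hdB dV hdV hVA hVB dW hdW (1, x) * g)) U :=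
  hhol _

/-- **the translated corner family read through the scalar, as functions of `s`**: `(s ↦ f_s(p₀ · blkD(1,x) · g)) = (s ↦ σ_{χ,s}(p₀) · f_s(blkD(1,x) · g))` — with
`s ↦ σ_{χ,s}(p₀)` ENTIRE and zero-free (★ `K2LiuRankOneCentreContinuation.differentiable_siegelDeltaCharacter`), holomorphy statements pass freely between the translated
corner family and the plain pulled-back family `s ↦ f_s(blkD(1,x) · g)` of ★ p862495. [cite: KudlaRallis1994, §2] [cite: Tan1999, §1] -/
theorem cornerTranslate_family_eq_mul {χ : HeckeCharacter L} {f : ℂ → HA L eV dV hdV dW hdW → ℂ}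
    (hf : ∀ s, IsSiegelDeltaSection L eV dV hdV dW hdW χ s (f s)) {p₀ : HA L eV dV hdV dW hdW} (hp₀ : IsSiegelDelta L eV dV hdV dW hdW p₀)
    (g : HA L eV dV hdV dW hdW) (x : HA L eB dB hdB dW hdW) :
    (fun s => f s (p₀ * blkD L eV eA eB dA hdA dB hdB dV hdV hVA hVB dW hdW (1, x) * g)) =
      fun s => siegelDeltaCharacter L eV dV hdV dW hdW χ s p₀ * f s (blkD L eV eA eB dA hdA dB hdB dV hdV hVA hVB dW hdW (1, x) * g) :=
  funext fun s => cornerTranslate_eq_mul L eV eA eB dA hdA dB hdB dV hdV hVA hVB dW hdW (hf s) hp₀ g x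

end Summit.HodgeConjecture.HodgeConjecture.Cruxes.HLiu418.K2LiuKindOneLineWhittakerTranslate

end
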